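import Mathlib
import Summits.Ventures.HodgeRepro2.T5ConductorArithmetic
import Summits.Ventures.HodgeRepro2.T6N5TateTwist
import Summits.Ventures.HodgeRepro2.T6N5Hyp
import Summits.Ventures.HodgeRepro2.T6N5LocalDatum

/-!
# T6N5LocalCharDatum — Tier 6, M2 sub-step N5 (t6-p8's half): the local sign datum at a finite non-split
place built from CONCRETE characters (data only) — the common core of the inert and the ramified cuts

TIER5 §N5.11.5 case (iii) of Theorem N5.T2 (the forced opposite signs at `v ∈ S_g` with `s_a = s_b`) is proved
in print-derived form from the parity / twisting rules of the local root numbers and elementary conductor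
arithmetic (§N5.12.2: Lemmas N5.L5, N5.L6, Theorem N5.T2′). To state the printed inputs FAITHFULLY and to PROVE
the arithmetic, the characters are carried concretely: `E = E_v^×` is a commutative group with its principal-unit
filtration `U` (`U 0 = O_E^×`, `U n = 1 + P_E^n`), `F_v^× = Fsub ⊆ E`, the characters are the group homomorphisms
`E →* ℂˣ`, «conjugate-symplectic» / «conjugate-orthogonal» are the restriction conditions of `T6N5LocalDatum`
applied to the restriction `E →* ℂˣ → Fsub →* ℂˣ`, the conductor `a(ξ)` is p4's `T5ConductorArithmetic.conductor
U ξ`, and the root numbers are Tate's `ε(χ, ψ, dx)` in t6-p7's carrier-free vocabulary (`T6N5TateTwist.TateData`),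
so that `ε_v(ξ) := ε(½, ξ, ψ_δ)` (TIER5 §N5.11.2) is DEFINED as the sign of `tate.epsS (1/2) ξ ψδ`.
`toLocalSignDatum` is the `LocalSignDatum` of `T6N5LocalDatum` built from these carriers, so that
`T6N5Local.N5Local_main` applies to it. The same file holds the elementary lemmas over `CharDatum` (restriction
conditions, smoothness and conductor arithmetic through p4's `T5ConductorArithmetic`, the sign of a root number,
t6-p7's Tate rules from the display `Hyp.Tate1979_3_2_2_3` and the normalisation conventions) and the two
extensions the printed inputs of the inert and the ramified cuts name: `N5LocalInertDatum.InertSignDatum`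
(Gan–Gross–Prasad's Proposition 3.1 / Lemma N5.L5: the inert predicate, the normalised `ψ₀`, `t`, `d_v`) and
`N5LocalRamDatum.RamifiedSignDatum` (Tate's (3.2.6.3) / GGP's Proposition 5.1 (2): a uniformiser `π`, Tate's
`n(ψ)`, the predicate «ψ^σ = ψ^{−1}»).
README §8(d): uses an L-value-free non-vanishing device: NO.
-/

namespace Summit.Ventures.HodgeRepro2.T6.N5LocalCharDatum

open Summit.Ventures.HodgeRepro2.T6.N5LocalDatum Summit.Ventures.HodgeRepro2.T6.N5TateTwist
  Summit.Ventures.HodgeRepro2.T5ConductorArithmetic Summit.Ventures.HodgeRepro2.T6.Hyp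

/-- The local sign datum at a finite non-split place `v` of `F` with concrete characters (TIER5 §N5.11.2
notation; data only): the multiplicative group `E_v^×` with its principal-unit filtration and the subgroup
`F_v^×`, the quadratic character `η_v` of `F_v^×`, Tate's carriers for the local ε-factor (t6-p7's `TateData`
fields over the same characters), the datum's additive character `ψ_δ`, and the remaining fields of
`LocalSignDatum` (`χ_W`, `ϵ_δ(W)`, the theta predicate, the line symbols). -/
structure CharDatum where
  /-- `E_v^×` (as an abstract commutative group). -/
  E : Type
  [instE : CommGroup E]
  /-- the principal-unit filtration: `U 0 = O_E^×`, `U n = U_E^n = 1 + P_E^n` (`n ≥ 1`) — antitone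
  (Biswas §2 / TIER5 §N5.11.2 «`U_E^k := 1 + P_E^k`»). -/
  U : ℕ → Subgroup E
  /-- `F_v^× ⊆ E_v^×`. -/
  Fsub : Subgroup E
  /-- `η_v = ω_{E_v/F_v}`, the quadratic character of `F_v^×` attached to `E_v/F_v`. -/
  η : Fsub →* ℂˣ
  /-- additive characters of `E_v` (Tate's `ψ`). -/
  Psi : Type
  /-- Haar measures on `E_v` (Tate's `dx`). -/
  Meas : Type
  /-- the unramified characters `ω_s = ‖·‖^s` of `E_v^×`. -/
  omega : ℂ → (E →* ℂˣ)
  /-- the normalised absolute value `‖a‖` on `E_v^×`. -/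
  nrm : E → ℝ
  /-- `ψ_a = ψ(a·)` (Tate's `ψ(ax)`). -/
  tw : Psi → E → Psi
  /-- `r · dx` for `r > 0`. -/
  sc : ℝ → Meas → Meas
  /-- the Haar measure self-dual for `ψ`. -/
  sd : Psi → Meas
  /-- Tate's local ε-factor `ε(χ, ψ, dx)` (Tate 1979 §3.2, the local functional equation (3.2.1)). -/
  epsT : (E →* ℂˣ) → Psi → Meas → ℂ
  /-- the datum's additive character `ψ_δ = ψ_v ∘ tr_{E_v/F_v}(δ ·)` (TIER5 §N5.11.2). -/
  ψδ : Psi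
  /-- `χ_W = ξ′_{A,v}`, the splitting character of the datum's skew-hermitian line. -/
  χW : E →* ℂˣ
  /-- `ϵ_δ(W)`. -/
  epsdW : ℤˣ
  /-- `Θ_{V_s,W,ι̃,ψ}(α ∘ i′_V) ≠ 0` for the hermitian line `V_s`, stated for `ξ = α_K`. -/
  Theta : ℤˣ → (E →* ℂˣ) → Prop
  /-- `ω_{E_v/F_v}(λ_a)`, `ω_{E_v/F_v}(λ_b)`. -/
  ηLine : Fin 2 → ℤˣ
  /-- `η_v(u)`. -/
  ηu : ℤˣ

attribute [instance] CharDatum.instE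

namespace CharDatum

noncomputable section

variable (C : CharDatum)

/-- Tate's carriers over the datum's characters: the evaluation `ev ξ a = ξ(a)` is the value of the
homomorphism (definitional), the other fields are the datum's. -/
abbrev tate : TateData C.E (C.E →* ℂˣ) C.Psi C.Meas where
  ev := fun ξ a => ((ξ a : ℂˣ) : ℂ)
  omega := C.omega
  nrm := C.nrm
  tw := C.tw
  sc := C.sc
  sd := C.sd
  eps := C.epsT

/-- The sign `±1` of a complex number: `toSign z = 1` iff `z = 1`, else `−1` (used on the root numbers, which are
`±1` for conjugate-dual characters). -/
def toSign (z : ℂ) : ℤˣ := if z = 1 then 1 else -1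

/-- `ε_v(ξ) := ε(½, ξ, ψ_δ)` as a sign (TIER5 §N5.11.2, Borade's `ε_{E_v/F_v}(ξ, ψ_v, δ)`): the sign of Tate's
`ε(ξ ω_{1/2}, ψ_δ, dx_{ψ_δ})`. -/
def eps (ξ : C.E →* ℂˣ) : ℤˣ := toSign (C.tate.epsS (1 / 2) ξ C.ψδ)

/-- The conductor exponent `a(ξ)` (p4's `conductor`: the least `n` with `ξ` trivial on `U n`). -/
def cond (ξ : C.E →* ℂˣ) : ℕ := conductor C.U ξ

/-- `ξ` is smooth (continuous for the profinite topology of the units): trivial on some `U n`. -/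
def IsSmooth (ξ : C.E →* ℂˣ) : Prop := ∃ n, C.U n ≤ ξ.ker

/-- `ξ` is unramified: trivial on the units `U 0 = O_E^×` (Tate (3.2.6): «a(χ) = 0 if χ is unramified»). -/
def IsUnramified (ξ : C.E →* ℂˣ) : Prop := C.U 0 ≤ ξ.ker

/-- The local sign datum of `T6N5LocalDatum` built from the concrete carriers: characters = homomorphisms
`E →* ℂˣ`, restriction to `F_v^×` = `MonoidHom.restrictHom`, `ε_v` = `eps`. -/
abbrev toLocalSignDatum : LocalSignDatum where
  Char := C.E →* ℂˣ
  instChar := inferInstance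
  FChar := C.Fsub →* ℂˣ
  instFChar := inferInstance
  res := MonoidHom.restrictHom C.Fsub ℂˣ
  η := C.η
  eps := C.eps
  χW := C.χW
  epsdW := C.epsdW
  Theta := C.Theta
  ηLine := C.ηLine
  ηu := C.ηu

/-- The conventions of the s-parametrised normalisation (t6-p7's `TateData.Rules` minus the two printed clauses
of Tate's (3.2.2)–(3.2.3), which the display `Hyp.Tate1979_3_2_2_3` supplies): `ω_s(a) = ‖a‖^s`, `‖a‖ > 0`
on `E_v^×`, and the self-dual measure of `ψ_a` is `‖a‖^{1/2} dx_ψ`. -/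
structure Conventions : Prop where
  /-- `ω_s(a) = ‖a‖^s`. -/
  ev_omega : ∀ (s : ℂ) (a : C.E), (((C.omega s) a : ℂˣ) : ℂ) = (C.nrm a : ℂ) ^ s
  /-- `‖a‖ > 0` on `E_v^×`. -/
  nrm_pos : ∀ a, 0 < C.nrm a
  /-- `dx_{ψ_a} = ‖a‖^{1/2} dx_ψ`. -/
  sd_tw : ∀ ψ a, C.sd (C.tw ψ a) = C.sc (Real.sqrt (C.nrm a)) (C.sd ψ)

/-! ### The elementary lemmas over `CharDatum` -/


/-! ### The restriction conditions on the concrete characters -/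

/-- «conjugate-symplectic» on the concrete carrier: `ξ(x) = η_v(x)` for every `x ∈ F_v^×`. -/
theorem isCS_iff (ξ : C.E →* ℂˣ) : C.toLocalSignDatum.IsCS ξ ↔ ∀ x : C.Fsub, ξ x = C.η x := by
  change ξ.restrict C.Fsub = C.η ↔ _
  rw [MonoidHom.ext_iff]
  simp only [MonoidHom.restrict_apply]

/-- «conjugate-orthogonal» on the concrete carrier: `ξ(x) = 1` for every `x ∈ F_v^×`. -/
theorem isCO_iff (ξ : C.E →* ℂˣ) : C.toLocalSignDatum.IsCO ξ ↔ ∀ x : C.Fsub, ξ x = 1 := by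
  change ξ.restrict C.Fsub = 1 ↔ _
  rw [MonoidHom.ext_iff]
  simp only [MonoidHom.restrict_apply, MonoidHom.one_apply]

/-- conjugate-symplectic · conjugate-orthogonal = conjugate-symplectic (TIER5 (A2)). -/
theorem isCS_mul_of_isCO {μ β : C.E →* ℂˣ} (hμ : C.toLocalSignDatum.IsCS μ)
    (hβ : C.toLocalSignDatum.IsCO β) : C.toLocalSignDatum.IsCS (μ * β) := by
  rw [isCS_iff] at hμ ⊢
  rw [isCO_iff] at hβ
  intro x
  rw [MonoidHom.mul_apply, hμ x, hβ x, mul_one]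

/-- `c⁻¹·a·a` is conjugate-symplectic when `a` and `c` are (`η_v⁻¹ η_v η_v = η_v`). -/
theorem isCS_inv_mul_mul {a c : C.E →* ℂˣ} (ha : C.toLocalSignDatum.IsCS a)
    (hc : C.toLocalSignDatum.IsCS c) : C.toLocalSignDatum.IsCS (c⁻¹ * a * a) := by
  rw [isCS_iff] at ha hc ⊢
  intro x
  rw [MonoidHom.mul_apply, MonoidHom.mul_apply, MonoidHom.inv_apply, hc x, ha x, inv_mul_cancel, one_mul]

/-! ### Smoothness and conductors -/

/-- The inverse of a smooth character is smooth. -/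
theorem isSmooth_inv {ξ : C.E →* ℂˣ} (h : C.IsSmooth ξ) : C.IsSmooth ξ⁻¹ :=
  (exists_le_ker_inv_iff ξ).mpr h

/-- Products of smooth characters are smooth. -/
theorem isSmooth_mul (hU : Antitone C.U) {ξ ζ : C.E →* ℂˣ} (hξ : C.IsSmooth ξ) (hζ : C.IsSmooth ζ) :
    C.IsSmooth (ξ * ζ) :=
  exists_le_ker_mul hU hξ hζ

/-- `a(ξ⁻¹) = a(ξ)` (p4's `conductor_inv`). -/
theorem cond_inv (ξ : C.E →* ℂˣ) : C.cond ξ⁻¹ = C.cond ξ := conductor_inv ξ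

/-- An unramified character is smooth. -/
theorem isSmooth_of_isUnramified {ξ : C.E →* ℂˣ} (h : C.IsUnramified ξ) : C.IsSmooth ξ := ⟨0, h⟩

/-- An unramified character has conductor `0` (Tate (3.2.6)). -/
theorem cond_eq_zero_of_isUnramified {ξ : C.E →* ℂˣ} (h : C.IsUnramified ξ) : C.cond ξ = 0 :=
  Nat.le_zero.mp (conductor_le_of_le_ker h)

/-- `a(ξ ζ) = a(ξ)` when `a(ζ) < a(ξ)` (p4's `conductor_mul_eq_of_lt`). -/
theorem cond_mul_eq_of_lt (hU : Antitone C.U) {ξ ζ : C.E →* ℂˣ} (hξ : C.IsSmooth ξ) (hζ : C.IsSmooth ζ)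
    (h : C.cond ζ < C.cond ξ) : C.cond (ξ * ζ) = C.cond ξ :=
  conductor_mul_eq_of_lt hU hξ hζ h

/-- `a(ξ ζ) ≤ max (a(ξ), a(ζ))` (p4's `conductor_mul_le`). -/
theorem cond_mul_le (hU : Antitone C.U) {ξ ζ : C.E →* ℂˣ} (hξ : C.IsSmooth ξ) (hζ : C.IsSmooth ζ) :
    C.cond (ξ * ζ) ≤ max (C.cond ξ) (C.cond ζ) :=
  conductor_mul_le hU hξ hζ

/-- `a(ξ ζ) = a(ξ)` when `ζ` is unramified. -/
theorem cond_mul_of_isUnramified (hU : Antitone C.U) {ξ ζ : C.E →* ℂˣ} (hξ : C.IsSmooth ξ)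
    (hζ : C.IsUnramified ζ) : C.cond (ξ * ζ) = C.cond ξ := by
  have hζs := isSmooth_of_isUnramified C hζ
  have h0 := cond_eq_zero_of_isUnramified C hζ
  rcases Nat.eq_zero_or_pos (C.cond ξ) with hξ0 | hξpos
  · have := cond_mul_le C hU hξ hζs
    rw [hξ0, h0, max_self] at this
    omega
  · exact cond_mul_eq_of_lt C hU hξ hζs (by omega)

/-- `a(c⁻¹ a a) = a(c)` when `a(a) < a(c)`. -/
theorem cond_inv_mul_mul (hU : Antitone C.U) {a c : C.E →* ℂˣ} (ha : C.IsSmooth a) (hc : C.IsSmooth c)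
    (h : C.cond a < C.cond c) : C.cond (c⁻¹ * a * a) = C.cond c := by
  have hassoc : c⁻¹ * a * a = c⁻¹ * (a * a) := by
    ext x
    simp only [MonoidHom.mul_apply, MonoidHom.inv_apply, mul_assoc]
  have haa : C.cond (a * a) ≤ C.cond a := by
    have := cond_mul_le C hU ha ha
    rwa [max_self] at this
  rw [hassoc, cond_mul_eq_of_lt C hU (isSmooth_inv C hc) (isSmooth_mul C hU ha ha)
    (by rw [cond_inv]; omega), cond_inv]

/-- Conjugate-symplectic smooth characters of every conductor `n ≥ 1`, from an unramified conjugate-symplectic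
`μ` and conjugate-orthogonal characters of every exact level (TIER5 Lemma N5.L5, the sentence after the proof:
«μ·β_a … a(μβ_a) = a for a ≥ 1»). -/
theorem exists_isCS_cond (hU : Antitone C.U)
    (hμ : ∃ μ : C.E →* ℂˣ, C.toLocalSignDatum.IsCS μ ∧ C.IsUnramified μ)
    (hβ : ∀ n : ℕ, 1 ≤ n → ∃ β : C.E →* ℂˣ, C.toLocalSignDatum.IsCO β ∧ C.IsSmooth β ∧ C.cond β = n)
    (n : ℕ) (hn : 1 ≤ n) :
    ∃ ξ : C.E →* ℂˣ, C.toLocalSignDatum.IsCS ξ ∧ C.IsSmooth ξ ∧ C.cond ξ = n := by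
  obtain ⟨μ, hμCS, hμu⟩ := hμ
  have hμs := isSmooth_of_isUnramified C hμu
  have hμ0 := cond_eq_zero_of_isUnramified C hμu
  obtain ⟨β, hβCO, hβs, hβn⟩ := hβ n hn
  refine ⟨μ * β, isCS_mul_of_isCO C hμCS hβCO, isSmooth_mul C hU hμs hβs, ?_⟩
  have hne : C.cond μ ≠ C.cond β := by rw [hμ0, hβn]; omega
  change conductor C.U (μ * β) = n
  rw [conductor_mul_eq_of_ne hU hμs hβs hne]
  change max (C.cond μ) (C.cond β) = n
  rw [hμ0, hβn, max_eq_right (Nat.zero_le n)]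

/-! ### The sign of a root number -/

/-- `toSign 1 = 1`. -/
theorem toSign_one : toSign 1 = 1 := by simp [toSign]

/-- `toSign (−1) = −1`. -/
theorem toSign_neg_one : toSign (-1) = -1 := by
  simp only [toSign]
  rw [if_neg]
  intro h
  have : (-1 : ℂ).re = (1 : ℂ).re := by rw [h]
  norm_num at this

/-- `toSign ((−1)^k) = (−1)^k` (the complex sign transported to `ℤˣ`, as `Int.negOnePow k`). -/
theorem toSign_neg_one_zpow (k : ℤ) : toSign ((-1 : ℂ) ^ k) = Int.negOnePow k := by
  rcases Int.even_or_odd k with hk | hk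
  · rw [(hk.neg_one_zpow : (-1 : ℂ) ^ k = 1), Int.negOnePow_even k hk, toSign_one]
  · rw [(hk.neg_one_zpow : (-1 : ℂ) ^ k = -1), Int.negOnePow_odd k hk, toSign_neg_one]

/-- `toSign` of `z · (−1)^k` for `z = ±1`: the sign multiplies. -/
theorem toSign_mul_neg_one_zpow {z : ℂ} (hz : z = 1 ∨ z = -1) (k : ℤ) :
    toSign (z * (-1 : ℂ) ^ k) = toSign z * Int.negOnePow k := by
  rcases hz with hz | hz
  · rw [hz, one_mul, toSign_one, one_mul, toSign_neg_one_zpow]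
  · rw [hz, toSign_neg_one]
    rcases Int.even_or_odd k with hk | hk
    · rw [(hk.neg_one_zpow : (-1 : ℂ) ^ k = 1), Int.negOnePow_even k hk, mul_one, toSign_neg_one, mul_one]
    · rw [(hk.neg_one_zpow : (-1 : ℂ) ^ k = -1), Int.negOnePow_odd k hk, neg_one_mul, neg_neg, toSign_one,
        neg_one_mul, neg_neg]

/-- The sign of `(−1)^k · z` for `z = ±1` (commuted form). -/
theorem toSign_neg_one_zpow_mul {z : ℂ} (hz : z = 1 ∨ z = -1) (k : ℤ) :
    toSign ((-1 : ℂ) ^ k * z) = Int.negOnePow k * toSign z := by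
  rw [mul_comm, toSign_mul_neg_one_zpow hz, mul_comm]

/-! ### Tate's rules from the display and the conventions -/

/-- t6-p7's `TateData.Rules` for the datum's carriers, from the displayed (3.2.2)–(3.2.3) and the conventions. -/
theorem rules_of (hT : Tate1979_3_2_2_3 C.epsT (fun ξ a => ((ξ a : ℂˣ) : ℂ)) C.tw C.sc C.nrm (fun _ => True))
    (hc : C.Conventions) : C.tate.Rules (fun _ => True) where
  scale := hT.1
  twist := hT.2
  ev_mul := fun ξ ξ' a => by
    change (((ξ * ξ') a : ℂˣ) : ℂ) = ((ξ a : ℂˣ) : ℂ) * ((ξ' a : ℂˣ) : ℂ)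
    rw [MonoidHom.mul_apply, Units.val_mul]
  ev_omega := hc.ev_omega
  nrm_pos := fun a _ => hc.nrm_pos a
  sd_tw := hc.sd_tw


end

end CharDatum

end Summit.Ventures.HodgeRepro2.T6.N5LocalCharDatum

namespace Summit.Ventures.HodgeRepro2.T6.N5LocalInertDatum

open Summit.Ventures.HodgeRepro2.T6.N5LocalCharDatum

/-- The local sign datum at an INERT place `v` (TIER5 §N5.11.2 / §N5.12.2 notation; data only): the core
`CharDatum` with the inert predicate, the normalised `ψ₀` of Proposition 3.1, the scaling element `t` and the
additive conductor `d_v`. -/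
structure InertSignDatum extends CharDatum where
  /-- «`k` is the unramified quadratic field extension of `k_0`»: the place `v` is inert in `E/F` (the standing
  hypothesis of Proposition 3.1, carried as a predicate of the datum). -/
  IsInert : Prop
  /-- «`ψ` is an additive character of `k` which is trivial on both `k_0` and the maximal ideal of the ring of
  integers `A_k`, but is nontrivial on `A_k`» (Proposition 3.1's normalisation of `ψ`; `n(ψ) = −1`). -/
  IsNormalised : Psi → Prop
  /-- the normalised additive character `ψ₀` (TIER5 Lemma N5.L5). -/
  ψ0 : Psi
  /-- `t ∈ F_v^×` with `ψ_δ = ψ₀(t·)` (TIER5 Lemma N5.L5, (A1′)). -/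
  t : E
  /-- `d_v := n(ψ_δ)`, the additive conductor of `ψ_δ` in the convention of Biswas §2 / Tate (3.2.6). -/
  d : ℤ

end Summit.Ventures.HodgeRepro2.T6.N5LocalInertDatum

namespace Summit.Ventures.HodgeRepro2.T6.N5LocalRamDatum

open Summit.Ventures.HodgeRepro2.T6.N5LocalCharDatum

/-- The local sign datum at a RAMIFIED place `v` (TIER5 §N5.11.2 / §N5.12.2 notation; data only): the core
`CharDatum` with a uniformiser, Tate's additive conductor and the conjugation predicate on additive characters. -/
structure RamifiedSignDatum extends CharDatum where
  /-- a uniformiser `π = π_E` of `E_v` (Tate (3.2.6): «π»). -/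
  π : E
  /-- `n(ψ)`, «the largest integer n such that ψ(π^{−n}𝒪) = 1» (Tate (3.2.6); Biswas §2; TIER5 §N5.11.2
  `d_v := n(ψ_δ)`). -/
  n : Psi → ℤ
  /-- «the additive character ψ of k satisfies ψ^σ = ψ^{−1}» (Gan–Gross–Prasad 2012 Proposition 5.1 (2);
  for `ψ_δ`: `ψ_δ(x̄) = ψ_δ(x)^{−1}` since `δ̄ = −δ`, TIER5 Lemma N5.L6 (1)). -/
  IsConjInv : Psi → Prop

end Summit.Ventures.HodgeRepro2.T6.N5LocalRamDatum

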